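import Literature.AlgebraicGeometry.Resolution.SemiStableCurvesReduced
import Literature.AlgebraicGeometry.Resolution.OrdinaryDoublePointReduced
import Literature.AlgebraicGeometry.Resolution.ComponentsUnderIntegralFlat
import Literature.AlgebraicGeometry.Resolution.SmoothLocusBaseChange
import Literature.AlgebraicGeometry.Morphisms.SmoothOfFlatFibre
import Mathlib.AlgebraicGeometry.Morphisms.LocalFlatDescent
import Mathlib.RingTheory.AdicCompletion.AsTensorProduct
import Mathlib.RingTheory.AdicCompletion.LocalRing
import Mathlib.RingTheory.Ideal.GoingDown
import Mathlib.FieldTheory.IsAlgClosed.AlgebraicClosure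
import Literature.RingTheory.KrullDimension.BaseChangeDimension
import HarnessLib

/-!
# Fibres of a semi-stable curve: branches through a point, smoothness at generic points

Topic: `Literature/AlgebraicGeometry/Resolution`. For a semi-stable curve `p : 𝒞 → S`
(de Jong 1996, 2.21: flat, proper, of finite presentation, geometric fibres connected with at
most ordinary double points, `IsSemiStableCurve`) and a point `s ∈ S`, the two properties of
the fibre `𝒞_s` that de Jong's three-point argument (Lemma 4.20, Cases 1 and 2, p. 74) rests on:

* **at most two branches through a point**: through a point `c` of the fibre which is closed
  in it pass at most two irreducible components of the fibre — "we get at least three distinct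
  components through the point `c ∈ 𝒞_s̄`. This contradicts the semi-stability of the curve"
  (`IsSemiStableCurve.not_three_genericPoints_specializes`); and through a point of the smooth
  locus `sm(𝒞/S)` passes only one (`eq_of_genericPoints_specializes_of_mem_smoothLocus`, for
  any morphism locally of finite presentation) — Case 2: two curves "meet in the labeled point
  `c = c_α`", a smooth point of the fibre;
* **the smooth locus is dense in the fibres**: every generic point of an irreducible component
  of `𝒞_s` lies in `sm(𝒞/S)` (`IsSemiStableCurve.mem_smoothLocus_of_mem_genericPoints_fiber`)
  — 4.21: "the smooth locus of `𝒞 → S` is dense in all fibres".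

Components through `c` are read off as minimal primes of the local ring of the fibre at `c`
(`exists_minimalPrimes_fromSpecStalk_eq`): one for a regular point; at most as many as in the
completion `K⟦u,v⟧/(uv)`, i.e. two, at an ordinary double point of the geometric fibre
(minimal primes lift along the flat local map to the completion). The passage between the fibre
`𝒞_s` over `κ(s)` and the geometric fibre over an algebraic closure is along the flat,
surjective, integral projection (generizations lift, fibres are discrete). Smoothness at generic
points: the geometric fibre is reduced, so its smooth locus is dense (Mathlib
`Scheme.Hom.dense_smoothLocus_of_perfectField`), smoothness descends along the field extension
(Mathlib `DescendsAlong @Smooth`) and ascends from the fibre to `p` at flat points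
(`Literature.AlgebraicGeometry.Morphisms.mem_smoothLocus_of_flat_stalkMap_of_smooth_fiber`).

## References

* A. J. de Jong, *Smoothness, semi-stability and alterations*, Publ. Math. IHÉS 83 (1996),
  2.21–2.23 (p. 61), Lemma 4.20 and 4.21 (pp. 73–74).
* The Stacks Project, Tags 0C47, 01V8, 03HV, 00GT.
-/

noncomputable section

open CategoryTheory CategoryTheory.Limits AlgebraicGeometry TopologicalSpace Topology IsLocalRing

namespace Literature.AlgebraicGeometry.Resolution

universe u

/-! ## Branches through a point and minimal primes of the local ring -/

section Branches

variable {F : Scheme.{u}}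

/-- **Irreducible components through a point come from minimal primes of its local ring**: if
`d` is the generic point of an irreducible component of `F` and `d ⤳ z`, then `d` is the image
under `Spec 𝒪_{F,z} → F` of a minimal prime of `𝒪_{F,z}` (the range of this map is the set of
generizations of `z`, Stacks 01J7, and below a prime mapping to `d` lies a minimal prime, which
still maps to a generization of the maximal point `d`). [cite: StacksProject, Tag 01J7] -/
theorem exists_minimalPrimes_fromSpecStalk_eq (z : F) {d : F} (hd : d ∈ genericPoints F)
    (hdz : d ⤳ z) :
    ∃ q : PrimeSpectrum (F.presheaf.stalk z), q.asIdeal ∈ minimalPrimes (F.presheaf.stalk z) ∧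
      F.fromSpecStalk z q = d := by
  have hmem : d ∈ Set.range (F.fromSpecStalk z) := by
    rw [Scheme.range_fromSpecStalk]; exact hdz
  obtain ⟨q', hq'⟩ := hmem
  obtain ⟨q₀, hq₀, hle⟩ := Ideal.exists_minimalPrimes_le (I := (⊥ : Ideal (F.presheaf.stalk z)))
    (J := q'.asIdeal) bot_le
  let q : PrimeSpectrum (F.presheaf.stalk z) := ⟨q₀, hq₀.1.1⟩
  have hspec : q ⤳ q' := (PrimeSpectrum.le_iff_specializes q q').mp hle
  refine ⟨q, hq₀, ?_⟩
  have h1 : F.fromSpecStalk z q ⤳ d := hq' ▸ hspec.map (F.fromSpecStalk z).continuous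
  exact (mem_genericPoints_iff_forall_specializes.mp hd) _ h1

/-- **Only one irreducible component passes through a point whose local ring is a domain.**
[folklore] -/
theorem eq_of_genericPoints_specializes_of_isDomain (z : F) [IsDomain (F.presheaf.stalk z)]
    {d₁ d₂ : F} (hd₁ : d₁ ∈ genericPoints F) (hd₂ : d₂ ∈ genericPoints F) (h₁ : d₁ ⤳ z)
    (h₂ : d₂ ⤳ z) : d₁ = d₂ := by
  obtain ⟨q₁, hq₁, rfl⟩ := exists_minimalPrimes_fromSpecStalk_eq z hd₁ h₁
  obtain ⟨q₂, hq₂, rfl⟩ := exists_minimalPrimes_fromSpecStalk_eq z hd₂ h₂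
  rw [IsDomain.minimalPrimes_eq_singleton_bot, Set.mem_singleton_iff] at hq₁ hq₂
  have : q₁ = q₂ := PrimeSpectrum.ext (hq₁.trans hq₂.symm)
  rw [this]

/-- **At most two irreducible components pass through a point whose local ring has at most two
minimal primes** (pigeonhole on `exists_minimalPrimes_fromSpecStalk_eq`). [folklore] -/
theorem not_three_genericPoints_specializes_of_minimalPrimes (z : F)
    (h2 : ∀ P₁ ∈ minimalPrimes (F.presheaf.stalk z), ∀ P₂ ∈ minimalPrimes (F.presheaf.stalk z),
      ∀ P₃ ∈ minimalPrimes (F.presheaf.stalk z), P₁ = P₂ ∨ P₁ = P₃ ∨ P₂ = P₃)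
    {d₁ d₂ d₃ : F} (hd₁ : d₁ ∈ genericPoints F) (hd₂ : d₂ ∈ genericPoints F)
    (hd₃ : d₃ ∈ genericPoints F) (h₁ : d₁ ⤳ z) (h₂ : d₂ ⤳ z) (h₃ : d₃ ⤳ z) :
    d₁ = d₂ ∨ d₁ = d₃ ∨ d₂ = d₃ := by
  obtain ⟨q₁, hq₁, rfl⟩ := exists_minimalPrimes_fromSpecStalk_eq z hd₁ h₁
  obtain ⟨q₂, hq₂, rfl⟩ := exists_minimalPrimes_fromSpecStalk_eq z hd₂ h₂
  obtain ⟨q₃, hq₃, rfl⟩ := exists_minimalPrimes_fromSpecStalk_eq z hd₃ h₃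
  rcases h2 _ hq₁ _ hq₂ _ hq₃ with h | h | h
  · left; rw [PrimeSpectrum.ext h]
  · right; left; rw [PrimeSpectrum.ext h]
  · right; right; rw [PrimeSpectrum.ext h]

end Branches

/-! ## Minimal primes along a flat local homomorphism (e.g. the completion) -/

/-- **Minimal primes lift along flat local homomorphisms**: for a flat local homomorphism
`R → R'` of local rings and a minimal prime `𝔭` of `R` there is a minimal prime of `R'` lying
over `𝔭` (going down from the maximal ideals, then shrink to a minimal prime).
[cite: StacksProject, Tag 00ON] -/
theorem exists_minimalPrimes_comap_eq_of_flat_local {R R' : Type*} [CommRing R] [CommRing R']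
    [Algebra R R'] [IsLocalRing R] [IsLocalRing R'] [IsLocalHom (algebraMap R R')]
    [Module.Flat R R'] {p : Ideal R} (hp : p ∈ minimalPrimes R) :
    ∃ P ∈ minimalPrimes R', P.comap (algebraMap R R') = p := by
  haveI := hp.1.1
  haveI : (maximalIdeal R').LiesOver (maximalIdeal R) :=
    ⟨(IsLocalRing.maximalIdeal_comap (algebraMap R R')).symm⟩
  obtain ⟨Q, -, hQ, hQp⟩ := Ideal.exists_ideal_le_liesOver_of_le (p := p) (q := maximalIdeal R)
    (maximalIdeal R') (IsLocalRing.le_maximalIdeal (Ideal.IsPrime.ne_top ‹_›))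
  obtain ⟨P, hP, hPQ⟩ := Ideal.exists_minimalPrimes_le (I := (⊥ : Ideal R')) (J := Q) bot_le
  haveI := hP.1.1
  refine ⟨P, hP, le_antisymm ?_ ?_⟩
  · calc P.comap (algebraMap R R') ≤ Q.comap (algebraMap R R') := Ideal.comap_mono hPQ
      _ = p := (hQp.over).symm
  · exact hp.2 ⟨Ideal.comap_isPrime _ P, bot_le⟩
      (by calc P.comap (algebraMap R R') ≤ Q.comap (algebraMap R R') := Ideal.comap_mono hPQ
            _ = p := (hQp.over).symm)

/-- If any three minimal primes of `R'` have two equal, the same holds in `R`, for `R → R'` flat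
local. [folklore] -/
theorem minimalPrimes_two_of_flat_local {R R' : Type*} [CommRing R] [CommRing R']
    [Algebra R R'] [IsLocalRing R] [IsLocalRing R'] [IsLocalHom (algebraMap R R')]
    [Module.Flat R R']
    (h2 : ∀ P₁ ∈ minimalPrimes R', ∀ P₂ ∈ minimalPrimes R', ∀ P₃ ∈ minimalPrimes R',
      P₁ = P₂ ∨ P₁ = P₃ ∨ P₂ = P₃) :
    ∀ p₁ ∈ minimalPrimes R, ∀ p₂ ∈ minimalPrimes R, ∀ p₃ ∈ minimalPrimes R,
      p₁ = p₂ ∨ p₁ = p₃ ∨ p₂ = p₃ := by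
  intro p₁ hp₁ p₂ hp₂ p₃ hp₃
  obtain ⟨P₁, hP₁, rfl⟩ := exists_minimalPrimes_comap_eq_of_flat_local (R' := R') hp₁
  obtain ⟨P₂, hP₂, rfl⟩ := exists_minimalPrimes_comap_eq_of_flat_local (R' := R') hp₂
  obtain ⟨P₃, hP₃, rfl⟩ := exists_minimalPrimes_comap_eq_of_flat_local (R' := R') hp₃
  rcases h2 _ hP₁ _ hP₂ _ hP₃ with h | h | h
  · left; rw [h]
  · right; left; rw [h]
  · right; right; rw [h]

/-- The pigeonhole property of minimal primes is invariant under ring isomorphisms (minimal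
primes are transported by isomorphisms,
`Literature.RingTheory.KrullDimension.map_mem_minimalPrimes_of_ringEquiv`). [folklore] -/
theorem minimalPrimes_two_of_ringEquiv {R R' : Type*} [CommRing R] [CommRing R'] (e : R ≃+* R')
    (h2 : ∀ P₁ ∈ minimalPrimes R', ∀ P₂ ∈ minimalPrimes R', ∀ P₃ ∈ minimalPrimes R',
      P₁ = P₂ ∨ P₁ = P₃ ∨ P₂ = P₃) :
    ∀ p₁ ∈ minimalPrimes R, ∀ p₂ ∈ minimalPrimes R, ∀ p₃ ∈ minimalPrimes R,
      p₁ = p₂ ∨ p₁ = p₃ ∨ p₂ = p₃ := by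
  intro p₁ hp₁ p₂ hp₂ p₃ hp₃
  have H := h2 _ (Literature.RingTheory.KrullDimension.map_mem_minimalPrimes_of_ringEquiv e hp₁)
    _ (Literature.RingTheory.KrullDimension.map_mem_minimalPrimes_of_ringEquiv e hp₂)
    _ (Literature.RingTheory.KrullDimension.map_mem_minimalPrimes_of_ringEquiv e hp₃)
  have hinj : ∀ {a b : Ideal R}, a.map e = b.map e → a = b := by
    intro a b hab
    have ha : (a.map (e : R →+* R')).map (e.symm : R' →+* R) = a := Ideal.map_of_equiv e
    have hb : (b.map (e : R →+* R')).map (e.symm : R' →+* R) = b := Ideal.map_of_equiv e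
    rw [← ha, ← hb]
    exact congrArg (Ideal.map (e.symm : R' →+* R)) hab
  rcases H with h | h | h
  · left; exact hinj h
  · right; left; exact hinj h
  · right; right; exact hinj h

/-! ## The complete local ring of a node has two minimal primes -/

section Node

open _root_.MvPowerSeries

/-- In `K⟦x₀, x₁⟧` the ideal `(x_s)` is prime: it is the kernel of "setting `x_s = 0`",
`K⟦x₀, x₁⟧ → K⟦X⟧` (`MvPowerSeries.axisSeries`). [folklore] -/
theorem isPrime_span_X_fin_two (K : Type*) [Field K] {s t : Fin 2} (hst : s ≠ t) :
    (Ideal.span {(X s : MvPowerSeries (Fin 2) K)}).IsPrime := by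
  have hker : Ideal.span {(X s : MvPowerSeries (Fin 2) K)} =
      RingHom.ker (MvPowerSeries.axisSeries (R := K) t) := by
    ext φ
    rw [Ideal.mem_span_singleton, RingHom.mem_ker, MvPowerSeries.X_dvd_iff_axisSeries_eq_zero hst]
  rw [hker]
  exact RingHom.ker_isPrime _

/-- **The minimal primes of `K⟦u, v⟧/(uv)` are among `(u)` and `(v)`**: a prime containing `uv`
contains `u` or `v`, and `(u)`, `(v)` are primes containing `uv`. [folklore] -/
theorem minimalPrimes_nodeQuotient_subset (K : Type*) [Field K] {𝔓 : Ideal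
      (MvPowerSeries (Fin 2) K ⧸ Ideal.span {(X 0 * X 1 : MvPowerSeries (Fin 2) K)})}
    (h𝔓 : 𝔓 ∈ minimalPrimes _) :
    𝔓 = (Ideal.span {(X 0 : MvPowerSeries (Fin 2) K)}).map
        (Ideal.Quotient.mk (Ideal.span {(X 0 * X 1 : MvPowerSeries (Fin 2) K)})) ∨
      𝔓 = (Ideal.span {(X 1 : MvPowerSeries (Fin 2) K)}).map
        (Ideal.Quotient.mk (Ideal.span {(X 0 * X 1 : MvPowerSeries (Fin 2) K)})) := by
  haveI : 𝔓.IsPrime := h𝔓.1.1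
  have hsurj : Function.Surjective
      (Ideal.Quotient.mk (Ideal.span {(X 0 * X 1 : MvPowerSeries (Fin 2) K)})) :=
    Ideal.Quotient.mk_surjective
  -- `x₀ x₁ ∈ 𝔓 ∩ K⟦x₀,x₁⟧`
  have hmem : (X 0 * X 1 : MvPowerSeries (Fin 2) K) ∈
      𝔓.comap (Ideal.Quotient.mk (Ideal.span {(X 0 * X 1 : MvPowerSeries (Fin 2) K)})) := by
    have h0 : Ideal.Quotient.mk (Ideal.span {(X 0 * X 1 : MvPowerSeries (Fin 2) K)})
        (X 0 * X 1) = 0 :=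
      Ideal.Quotient.eq_zero_iff_mem.mpr (Ideal.subset_span rfl)
    rw [Ideal.mem_comap, h0]
    exact 𝔓.zero_mem
  -- the candidate minimal prime through `x_i`
  have key : ∀ (i j : Fin 2), i ≠ j → (X i : MvPowerSeries (Fin 2) K) ∈ 𝔓.comap
      (Ideal.Quotient.mk (Ideal.span {(X 0 * X 1 : MvPowerSeries (Fin 2) K)})) →
      (X i : MvPowerSeries (Fin 2) K) ∣ X 0 * X 1 →
      𝔓 = (Ideal.span {(X i : MvPowerSeries (Fin 2) K)}).map
        (Ideal.Quotient.mk (Ideal.span {(X 0 * X 1 : MvPowerSeries (Fin 2) K)})) := by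
    intro i j hij hi hdvd
    haveI := isPrime_span_X_fin_two K hij
    have hIle : Ideal.span {(X 0 * X 1 : MvPowerSeries (Fin 2) K)} ≤
        Ideal.span {(X i : MvPowerSeries (Fin 2) K)} := by
      rw [Ideal.span_singleton_le_span_singleton]
      exact hdvd
    have hprime : ((Ideal.span {(X i : MvPowerSeries (Fin 2) K)}).map
        (Ideal.Quotient.mk (Ideal.span {(X 0 * X 1 : MvPowerSeries (Fin 2) K)}))).IsPrime :=
      Ideal.map_isPrime_of_surjective hsurj (by rw [Ideal.mk_ker]; exact hIle)
    have hle : (Ideal.span {(X i : MvPowerSeries (Fin 2) K)}).map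
        (Ideal.Quotient.mk (Ideal.span {(X 0 * X 1 : MvPowerSeries (Fin 2) K)})) ≤ 𝔓 := by
      rw [← Ideal.map_comap_of_surjective _ hsurj 𝔓]
      exact Ideal.map_mono ((Ideal.span_singleton_le_iff_mem _).mpr hi)
    exact le_antisymm (h𝔓.2 ⟨hprime, bot_le⟩ hle) hle
  rcases (Ideal.IsPrime.mem_or_mem inferInstance hmem) with h0 | h1
  · exact Or.inl (key 0 1 (by decide) h0 (dvd_mul_right _ _))
  · exact Or.inr (key 1 0 (by decide) h1 (dvd_mul_left _ _))

/-- Pigeonhole: among any three minimal primes of `K⟦u, v⟧/(uv)` two coincide. [folklore] -/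
theorem minimalPrimes_two_nodeQuotient (K : Type*) [Field K] :
    ∀ P₁ ∈ minimalPrimes (MvPowerSeries (Fin 2) K ⧸
        Ideal.span {(X 0 * X 1 : MvPowerSeries (Fin 2) K)}),
      ∀ P₂ ∈ minimalPrimes (MvPowerSeries (Fin 2) K ⧸
        Ideal.span {(X 0 * X 1 : MvPowerSeries (Fin 2) K)}),
      ∀ P₃ ∈ minimalPrimes (MvPowerSeries (Fin 2) K ⧸
        Ideal.span {(X 0 * X 1 : MvPowerSeries (Fin 2) K)}),
      P₁ = P₂ ∨ P₁ = P₃ ∨ P₂ = P₃ := by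
  intro P₁ h₁ P₂ h₂ P₃ h₃
  rcases minimalPrimes_nodeQuotient_subset K h₁ with rfl | rfl <;>
    rcases minimalPrimes_nodeQuotient_subset K h₂ with rfl | rfl <;>
    rcases minimalPrimes_nodeQuotient_subset K h₃ with rfl | rfl <;> simp

end Node

/-- **At an ordinary double point at most two branches**: the local ring of a scheme at a point
whose completion is `K⟦u, v⟧/(uv)` (de Jong 1996, 2.23, `IsOrdinaryDoublePoint`) has the
pigeonhole property for minimal primes — its minimal primes lift injectively to the completion
(flat local), which has two. [cite: DeJong1996, 2.23, pp. 61–62] -/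
theorem IsOrdinaryDoublePoint.minimalPrimes_two {K : Type u} [Field K] {C : Scheme.{u}} {x : C}
    [IsNoetherianRing (C.presheaf.stalk x)] (h : IsOrdinaryDoublePoint K x) :
    ∀ P₁ ∈ minimalPrimes (C.presheaf.stalk x), ∀ P₂ ∈ minimalPrimes (C.presheaf.stalk x),
      ∀ P₃ ∈ minimalPrimes (C.presheaf.stalk x), P₁ = P₂ ∨ P₁ = P₃ ∨ P₂ = P₃ := by
  obtain ⟨e⟩ := h
  exact minimalPrimes_two_of_flat_local
    (R' := AdicCompletion (maximalIdeal (C.presheaf.stalk x)) (C.presheaf.stalk x))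
    (minimalPrimes_two_of_ringEquiv e (minimalPrimes_two_nodeQuotient K))

/-- A domain trivially has the pigeonhole property for minimal primes. [folklore] -/
theorem minimalPrimes_two_of_isDomain (R : Type*) [CommRing R] [IsDomain R] :
    ∀ P₁ ∈ minimalPrimes R, ∀ P₂ ∈ minimalPrimes R, ∀ P₃ ∈ minimalPrimes R,
      P₁ = P₂ ∨ P₁ = P₃ ∨ P₂ = P₃ := by
  intro P₁ h₁ P₂ h₂ P₃ h₃
  rw [IsDomain.minimalPrimes_eq_singleton_bot, Set.mem_singleton_iff] at h₁ h₂
  left; rw [h₁, h₂]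

/-! ## Passing to a flat integral cover (the geometric fibre) -/

section Cover

variable {F F' : Scheme.{u}} (π : F' ⟶ F)

/-- **Generic points specializing to `π c̃` lift to generic points specializing to `c̃`** along a
flat (generizations lift, Stacks 03HV) and integral (fibres are discrete, Stacks 00GT) morphism.
[cite: StacksProject, Tag 03HV] -/
theorem exists_mem_genericPoints_lift [Flat π] [IsIntegralHom π] (c' : F') {d : F}
    (hd : d ∈ genericPoints F) (hdc : d ⤳ π c') :
    ∃ d' ∈ genericPoints F', d' ⤳ c' ∧ π d' = d := by
  obtain ⟨d', hd'c, hd'⟩ := Flat.generalizingMap π hdc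
  refine ⟨d', ?_, hd'c, hd'⟩
  rw [mem_genericPoints_iff_forall_specializes]
  intro e he
  have h1 : π e ⤳ d := hd' ▸ he.map π.continuous
  have h2 : π e = d := (mem_genericPoints_iff_forall_specializes.mp hd) _ h1
  exact eq_of_specializes_of_isIntegralHom π he (h2.trans hd'.symm)

/-- Over a closed point, the points of an integral morphism are closed (no specializations in
the fibres, Stacks 00GT). [cite: StacksProject, Tag 00GT] -/
theorem isClosed_singleton_of_isIntegralHom [IsIntegralHom π] {c' : F'}
    (hc : IsClosed ({π c'} : Set F)) : IsClosed ({c'} : Set F') := by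
  rw [← closure_subset_iff_isClosed]
  intro z hz
  have hcz : c' ⤳ z := specializes_iff_mem_closure.mpr hz
  have h1 : π z ∈ closure ({π c'} : Set F) :=
    specializes_iff_mem_closure.mp (hcz.map π.continuous)
  rw [hc.closure_eq, Set.mem_singleton_iff] at h1
  exact (eq_of_specializes_of_isIntegralHom π hcz h1.symm).symm

/-- **At most two branches through a closed point, checked on a flat integral surjective cover**:
if at every closed point of `F'` the local ring has the pigeonhole property for minimal primes,
then through every closed point `c` of `F` pass at most two irreducible components (lift `c` and
the three generic points to `F'`). [folklore] -/
theorem not_three_genericPoints_specializes_of_cover [Flat π] [IsIntegralHom π] [Surjective π]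
    (hF' : ∀ x : F', IsClosed ({x} : Set F') →
      ∀ P₁ ∈ minimalPrimes (F'.presheaf.stalk x), ∀ P₂ ∈ minimalPrimes (F'.presheaf.stalk x),
        ∀ P₃ ∈ minimalPrimes (F'.presheaf.stalk x), P₁ = P₂ ∨ P₁ = P₃ ∨ P₂ = P₃)
    {c : F} (hc : IsClosed ({c} : Set F)) {d₁ d₂ d₃ : F} (hd₁ : d₁ ∈ genericPoints F)
    (hd₂ : d₂ ∈ genericPoints F) (hd₃ : d₃ ∈ genericPoints F) (h₁ : d₁ ⤳ c) (h₂ : d₂ ⤳ c)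
    (h₃ : d₃ ⤳ c) : d₁ = d₂ ∨ d₁ = d₃ ∨ d₂ = d₃ := by
  obtain ⟨c', hc'⟩ := π.surjective c
  subst hc'
  have hc'cl : IsClosed ({c'} : Set F') := isClosed_singleton_of_isIntegralHom π hc
  obtain ⟨e₁, he₁, he₁c, rfl⟩ := exists_mem_genericPoints_lift π c' hd₁ h₁
  obtain ⟨e₂, he₂, he₂c, rfl⟩ := exists_mem_genericPoints_lift π c' hd₂ h₂
  obtain ⟨e₃, he₃, he₃c, rfl⟩ := exists_mem_genericPoints_lift π c' hd₃ h₃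
  rcases not_three_genericPoints_specializes_of_minimalPrimes c' (hF' c' hc'cl) he₁ he₂ he₃ he₁c
    he₂c he₃c with h | h | h
  · left; rw [h]
  · right; left; rw [h]
  · right; right; rw [h]

end Cover

/-! ## The fibre of a semi-stable curve: at most two branches through a closed point -/

namespace IsSemiStableCurve

variable {C S : Scheme.{u}} {p : C ⟶ S}

/-- **de Jong 1996, 4.20, Case 1: "we get at least three distinct components through the point
`c ∈ 𝒞_s̄`. This contradicts the semi-stability of the curve `𝒞`."** For a semi-stable curve
`p : 𝒞 → S`, a point `s ∈ S` and a closed point `c` of the fibre `𝒞_s = p.fiber s`, among any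
three generic points of irreducible components of `𝒞_s` specializing to `c` two coincide. Pass
to the geometric fibre `𝒞_s ⊗_{κ(s)} K̄` (flat, integral, surjective over `𝒞_s`;
`not_three_genericPoints_specializes_of_cover`): its closed points are regular (local ring a
domain: one minimal prime) or ordinary double points (two minimal primes,
`IsOrdinaryDoublePoint.minimalPrimes_two`). [cite: DeJong1996, Lemma 4.20 Case 1, p. 74] -/
theorem not_three_genericPoints_fiber_specializes (h : IsSemiStableCurve p) (s : S)
    {c : ↥(p.fiber s)} (hc : IsClosed ({c} : Set ↥(p.fiber s))) {d₁ d₂ d₃ : ↥(p.fiber s)}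
    (hd₁ : d₁ ∈ genericPoints ↥(p.fiber s)) (hd₂ : d₂ ∈ genericPoints ↥(p.fiber s))
    (hd₃ : d₃ ∈ genericPoints ↥(p.fiber s)) (h₁ : d₁ ⤳ c) (h₂ : d₂ ⤳ c) (h₃ : d₃ ⤳ c) :
    d₁ = d₂ ∨ d₁ = d₃ ∨ d₂ = d₃ := by
  haveI := h.locallyOfFinitePresentation
  -- the geometric fibre over an algebraic closure `K̄` of `κ(s)`
  let K := S.residueField s
  let Kbar := AlgebraicClosure K
  let j : Spec (CommRingCat.of Kbar) ⟶ Spec K := Spec.map (CommRingCat.ofHom (algebraMap K Kbar))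
  let q := p.fiberToSpecResidueField s
  haveI : Flat j := flat_SpecMap_algebraMap_of_field K Kbar
  haveI : IsIntegralHom j := isIntegralHom_SpecMap_algebraMap_of_isAlgebraic K Kbar
  let π : pullback q j ⟶ p.fiber s := pullback.fst q j
  haveI : IsIntegralHom π := MorphismProperty.pullback_fst _ _ inferInstance
  -- it is the geometric fibre of `p` at `ȳ = (Spec K̄ → Spec κ(s) → S)`
  let e : pullback q j ≅ pullback p (j ≫ S.fromSpecResidueField s) :=
    pullbackLeftPullbackSndIso p (S.fromSpecResidueField s) j
  haveI : LocallyOfFiniteType q :=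
    MorphismProperty.pullback_snd (P := @LocallyOfFiniteType) _ _ inferInstance
  haveI : LocallyOfFiniteType (pullback.snd q j) :=
    MorphismProperty.pullback_snd (P := @LocallyOfFiniteType) _ _ inferInstance
  haveI : IsLocallyNoetherian (pullback q j) :=
    LocallyOfFiniteType.isLocallyNoetherian (f := pullback.snd q j)
  refine not_three_genericPoints_specializes_of_cover π (fun x hx => ?_) hc hd₁ hd₂ hd₃ h₁ h₂ h₃
  -- closed points of the geometric fibre: regular (domain) or ordinary double points
  have hcond := fibreCondition_of_iso Kbar e.symm
    (fun y hy => h.isRegularLocalRing_or_isOrdinaryDoublePoint Kbar (j ≫ S.fromSpecResidueField s)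
      y hy) x hx
  rcases hcond with ⟨hreg, -⟩ | hnode
  · haveI := hreg
    haveI := isDomain_of_isRegularLocalRing ((pullback q j).presheaf.stalk x)
    exact minimalPrimes_two_of_isDomain _
  · exact hnode.minimalPrimes_two

end IsSemiStableCurve

/-! ## One branch through a point of the smooth locus -/

/-- **de Jong 1996, 4.20, Case 2: two distinct components of the fibre cannot "meet in the
labeled point `c = c_α`"**, a point of the smooth locus. For `p : 𝒞 → S` locally of finite
presentation and `c ∈ sm(𝒞/S)`, among the generic points of irreducible components of the
fibre `𝒞_{p c}` at most one specializes to (the point of the fibre defined by) `c`: the fibre is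
smooth over `κ(p c)` at that point (base change of the smooth locus), so its local ring there is
regular (Stacks 056S), a domain, with a single minimal prime.
[cite: DeJong1996, Lemma 4.20 Case 2, p. 74] -/
theorem eq_of_genericPoints_fiber_specializes_of_mem_smoothLocus {C S : Scheme.{u}} (p : C ⟶ S)
    [LocallyOfFinitePresentation p] {c : C} (hc : c ∈ p.smoothLocus)
    {d₁ d₂ : ↥(p.fiber (p c))} (hd₁ : d₁ ∈ genericPoints ↥(p.fiber (p c)))
    (hd₂ : d₂ ∈ genericPoints ↥(p.fiber (p c))) (h₁ : d₁ ⤳ p.asFiber c) (h₂ : d₂ ⤳ p.asFiber c) :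
    d₁ = d₂ := by
  let q := p.fiberToSpecResidueField (p c)
  haveI : LocallyOfFinitePresentation q :=
    MorphismProperty.pullback_snd (P := @LocallyOfFinitePresentation) _ _ inferInstance
  -- `p.asFiber c` lies in the smooth locus of the fibre over `κ(p c)`
  have hc' : p.asFiber c ∈ q.smoothLocus := by
    refine Scheme.Hom.preimage_smoothLocus_le_smoothLocus_pullback_snd p
      (S.fromSpecResidueField (p c)) ?_
    show pullback.fst p (S.fromSpecResidueField (p c)) (p.asFiber c) ∈ p.smoothLocus
    change p.fiberι (p c) (p.asFiber c) ∈ p.smoothLocus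
    rw [Scheme.Hom.fiberι_asFiber]
    exact hc
  obtain ⟨V, hcV, hV⟩ := exists_smooth_ι_comp_of_mem_smoothLocus q hc'
  haveI : IsDomain ((V : Scheme.{u}).presheaf.stalk ⟨p.asFiber c, hcV⟩) :=
    @isDomain_stalk_of_smooth (S.residueField (p c)) _ _ (V.ι ≫ q) hV ⟨p.asFiber c, hcV⟩
  haveI : IsDomain ((p.fiber (p c)).presheaf.stalk (p.asFiber c)) :=
    MulEquiv.isDomain ((V : Scheme.{u}).presheaf.stalk ⟨p.asFiber c, hcV⟩)
      (asIso (V.ι.stalkMap ⟨p.asFiber c, hcV⟩)).commRingCatIsoToRingEquiv.toMulEquiv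
  exact eq_of_genericPoints_specializes_of_isDomain (p.asFiber c) hd₁ hd₂ h₁ h₂

/-! ## Smoothness at the generic points of the fibres -/

/-- **Smoothness of a flat morphism at points of an open of the fibre which is smooth over
`κ(s)`.** Let `p : 𝒞 → S` be flat and locally of finite presentation, `s ∈ S`, and `O` an open
of the fibre `𝒞_s` such that `O → Spec κ(s)` is smooth; then every point of `𝒞` coming from `O`
lies in `sm(𝒞/S)`. Indeed, for the open `W = 𝒞 ∖ cl(𝒞_s ∖ O)` of `𝒞` one has `W ∩ 𝒞_s = O`, the
fibre of `W → S` at `s` is `O`, smooth, and a point at which the morphism is flat with smooth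
fibre through it is a smooth point (Stacks 01V8,
`Literature.AlgebraicGeometry.Morphisms.mem_smoothLocus_of_flat_stalkMap_of_smooth_fiber`).
[cite: StacksProject, Tag 01V8] -/
theorem mem_smoothLocus_of_smooth_opens_fiber {C S : Scheme.{u}} (p : C ⟶ S)
    [LocallyOfFinitePresentation p] [Flat p] (s : S) (O : (p.fiber s).Opens)
    (hO : Smooth (O.ι ≫ p.fiberToSpecResidueField s)) (z : ↥(p.fiber s)) (hz : z ∈ O) :
    p.fiberι s z ∈ p.smoothLocus := by
  -- the open `W` of `C` with `W ∩ 𝒞_s = O`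
  let A : Set C := p.fiberι s '' ((O : Set ↥(p.fiber s))ᶜ)
  let W : C.Opens := ⟨(closure A)ᶜ, isClosed_closure.isOpen_compl⟩
  have hWO : p.fiberι s ⁻¹ᵁ W = O := by
    ext x
    constructor
    · intro hx
      by_contra hxO
      exact hx (subset_closure ⟨x, hxO, rfl⟩)
    · intro hxO hx
      have hemb := (p.fiberι s).isEmbedding
      have h2 : x ∈ closure ((O : Set ↥(p.fiber s))ᶜ) := by
        rw [hemb.closure_eq_preimage_closure_image]; exact hx
      rw [(O.isOpen.isClosed_compl).closure_eq] at h2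
      exact h2 hxO
  clear_value W
  subst hWO
  -- the fibre of `W → S` at `s` is `O`, hence smooth over `κ(s)`
  have hsm : Smooth ((W.ι ≫ p).fiberToSpecResidueField s) := by
    let i := S.fromSpecResidueField s
    let E : pullback (W.ι ≫ p) i ≅ ↑(pullback.fst p i ⁻¹ᵁ W) :=
      (pullbackRightPullbackFstIso p i W.ι).symm ≪≫ pullbackSymmetry W.ι (pullback.fst p i) ≪≫
        pullbackRestrictIsoRestrict (pullback.fst p i) W
    have hE : E.hom ≫ (pullback.fst p i ⁻¹ᵁ W).ι ≫ pullback.snd p i =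
        pullback.snd (W.ι ≫ p) i := by
      simp only [E, Iso.trans_hom, Iso.symm_hom, Category.assoc,
        pullbackRestrictIsoRestrict_hom_ι_assoc, pullbackSymmetry_hom_comp_fst_assoc,
        pullbackRightPullbackFstIso_inv_snd_snd]
    change Smooth (pullback.snd (W.ι ≫ p) i)
    rw [← hE]
    exact (MorphismProperty.cancel_left_of_respectsIso @Smooth E.hom _).mpr hO
  -- hence `W → S` is smooth at the point `z`
  have hzW : p.fiberι s z ∈ W := hz
  let x : W := ⟨p.fiberι s z, hzW⟩
  have hx : (W.ι ≫ p) x = s := by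
    show p (p.fiberι s z) = s
    exact Literature.AlgebraicGeometry.Motives.apply_fiberι p s z
  have hsm' : Smooth ((W.ι ≫ p).fiberToSpecResidueField ((W.ι ≫ p) x)) := by rw [hx]; exact hsm
  have key := Literature.AlgebraicGeometry.Morphisms.mem_smoothLocus_of_flat_stalkMap_of_smooth_fiber
    (W.ι ≫ p) (x := x) (Flat.stalkMap (W.ι ≫ p) x) hsm'
  rw [← Scheme.Hom.preimage_smoothLocus_eq] at key
  exact key

namespace IsSemiStableCurve

variable {C S : Scheme.{u}} {p : C ⟶ S}

/-- **de Jong 1996, 4.21: "the smooth locus of `𝒞 → S` is dense in all fibres"** — for a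
semi-stable curve `p : 𝒞 → S`, every generic point of an irreducible component of a fibre `𝒞_s`
lies in the smooth locus `sm(𝒞/S)`. Proof: the geometric fibre `𝒞_s ⊗ K̄` is reduced (2.21), so
its smooth locus over the perfect field `K̄` is dense (Mathlib
`Scheme.Hom.dense_smoothLocus_of_perfectField`) and contains all generic points, in particular
all points over `d` (these are generic, the projection being integral); the complement in `𝒞_s`
of the (closed) image of the non-smooth locus is an open `O ∋ d` whose base change to `K̄` is
smooth, so `O` is smooth over `κ(s)` by flat descent (Mathlib `DescendsAlong @Smooth`), and `p`,
being flat, is smooth at the points of `O` (`mem_smoothLocus_of_smooth_opens_fiber`).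
[cite: DeJong1996, 4.21, p. 74] -/
theorem mem_smoothLocus_of_mem_genericPoints_fiber (h : IsSemiStableCurve p)
    [LocallyOfFinitePresentation p] (s : S) {d : ↥(p.fiber s)}
    (hd : d ∈ genericPoints ↥(p.fiber s)) : p.fiberι s d ∈ p.smoothLocus := by
  haveI := h.flat
  haveI := h.isProper
  -- the geometric fibre over an algebraic closure `K̄` of `κ(s)`
  let K := S.residueField s
  let Kbar := AlgebraicClosure K
  let j : Spec (CommRingCat.of Kbar) ⟶ Spec K := Spec.map (CommRingCat.ofHom (algebraMap K Kbar))
  let q := p.fiberToSpecResidueField s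
  haveI : LocallyOfFinitePresentation q :=
    MorphismProperty.pullback_snd (P := @LocallyOfFinitePresentation) _ _ inferInstance
  haveI : Flat j := flat_SpecMap_algebraMap_of_field K Kbar
  haveI : IsIntegralHom j := isIntegralHom_SpecMap_algebraMap_of_isAlgebraic K Kbar
  let π : pullback q j ⟶ p.fiber s := pullback.fst q j
  let qbar : pullback q j ⟶ Spec (CommRingCat.of Kbar) := pullback.snd q j
  haveI : IsIntegralHom π := MorphismProperty.pullback_fst _ _ inferInstance
  haveI : LocallyOfFinitePresentation qbar :=
    MorphismProperty.pullback_snd (P := @LocallyOfFinitePresentation) _ _ inferInstance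
  -- it is reduced (2.21) and Noetherian
  let e : pullback q j ≅ pullback p (j ≫ S.fromSpecResidueField s) :=
    pullbackLeftPullbackSndIso p (S.fromSpecResidueField s) j
  haveI : IsReduced (pullback p (j ≫ S.fromSpecResidueField s)) :=
    h.isReduced_pullback_of_isAlgClosed Kbar (j ≫ S.fromSpecResidueField s)
  haveI : IsReduced (pullback q j) := isReduced_of_isOpenImmersion e.hom
  haveI : IsLocallyNoetherian (pullback q j) :=
    LocallyOfFiniteType.isLocallyNoetherian (f := qbar)
  haveI : CompactSpace ↥(pullback q j) := QuasiCompact.compactSpace_of_compactSpace π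
  haveI : IsNoetherian (pullback q j) := {}
  -- the smooth locus of the geometric fibre is dense, hence contains the generic points
  have hdense : Dense (qbar.smoothLocus : Set ↥(pullback q j)) :=
    qbar.dense_smoothLocus_of_perfectField
  have hgen : genericPoints ↥(pullback q j) ⊆ qbar.smoothLocus :=
    genericPoints_subset_of_isOpen_of_dense qbar.smoothLocus.isOpen hdense
  -- the open `O ∋ d` of `𝒞_s` off the image of the non-smooth locus
  have hZ : IsClosed (π '' (qbar.smoothLocus : Set ↥(pullback q j))ᶜ) :=
    π.isClosedMap _ qbar.smoothLocus.isOpen.isClosed_compl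
  let O : (p.fiber s).Opens := ⟨(π '' (qbar.smoothLocus : Set ↥(pullback q j))ᶜ)ᶜ, hZ.isOpen_compl⟩
  have hdO : d ∈ O := by
    rintro ⟨d', hd'Z, hd'd⟩
    apply hd'Z
    apply hgen
    rw [mem_genericPoints_iff_forall_specializes]
    intro e' he'
    have h1 : π e' ⤳ d := hd'd ▸ he'.map π.continuous
    have h2 : π e' = d := (mem_genericPoints_iff_forall_specializes.mp hd) _ h1
    exact eq_of_specializes_of_isIntegralHom π he' (h2.trans hd'd.symm)
  have hπO : π ⁻¹ᵁ O ≤ qbar.smoothLocus := by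
    intro y hy
    by_contra hy'
    exact hy ⟨y, hy', rfl⟩
  -- over `π⁻¹(O)` the geometric fibre is smooth, hence `O → Spec κ(s)` is smooth by descent
  have hsm' : Smooth ((π ⁻¹ᵁ O).ι ≫ qbar) := by
    rw [← Scheme.Hom.smoothLocus_eq_top_iff, ← Scheme.Hom.preimage_smoothLocus_eq]
    exact top_le_iff.mp fun y _ => hπO y.2
  have H : IsPullback ((π ⁻¹ᵁ O).ι ≫ qbar) (π ∣_ O) j (O.ι ≫ q) :=
    (isPullback_morphismRestrict π O).flip.paste_horiz (IsPullback.of_hasPullback q j).flip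
  have hQ : (@Surjective ⊓ @Flat ⊓ @QuasiCompact : MorphismProperty Scheme) j :=
    ⟨⟨inferInstance, inferInstance⟩, inferInstance⟩
  have hO : Smooth (O.ι ≫ q) :=
    MorphismProperty.of_isPullback_of_descendsAlong (P := @Smooth)
      (Q := @Surjective ⊓ @Flat ⊓ @QuasiCompact) H hQ hsm'
  exact mem_smoothLocus_of_smooth_opens_fiber p s O hO d hdO

end IsSemiStableCurve

/-! ## Points of `𝒞` in a fibre as points of the fibre scheme -/

section FibrePoints

variable {C S : Scheme.{u}} (p : C ⟶ S) {y : S}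

/-- Specialization between points of a fibre can be read in the fibre scheme `p.fiber y`
(`p.fiberι y` is an embedding). [folklore] -/
theorem fiberHomeo_symm_specializes_iff {a b : C} (ha : p a = y) (hb : p b = y) :
    (p.fiberHomeo y).symm ⟨a, ha⟩ ⤳ (p.fiberHomeo y).symm ⟨b, hb⟩ ↔ a ⤳ b := by
  rw [← (p.fiberι y).isEmbedding.specializes_iff, Scheme.Hom.fiberι_fiberHomeo_symm,
    Scheme.Hom.fiberι_fiberHomeo_symm]

/-- A point of the fibre scheme is determined by its image in `𝒞`. [folklore] -/
theorem eq_fiberHomeo_symm_of_fiberι_eq {z : ↥(p.fiber y)} {a : C} (ha : p a = y)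
    (h : p.fiberι y z = a) : z = (p.fiberHomeo y).symm ⟨a, ha⟩ := by
  apply (p.fiberι y).isEmbedding.injective
  rw [Scheme.Hom.fiberι_fiberHomeo_symm, h]

/-- **Maximal points of a fibre are generic points of the fibre scheme**: if no other point of
`p⁻¹(y)` specializes to `d`, the point of `p.fiber y` defined by `d` is the generic point of an
irreducible component. [folklore] -/
theorem fiberHomeo_symm_mem_genericPoints {d : C} (hd : p d = y)
    (H : ∀ e : C, p e = y → e ⤳ d → e = d) :
    (p.fiberHomeo y).symm ⟨d, hd⟩ ∈ genericPoints ↥(p.fiber y) := by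
  rw [mem_genericPoints_iff_forall_specializes]
  intro z hz
  have hpz : p (p.fiberι y z) = y := Literature.AlgebraicGeometry.Motives.apply_fiberι p y z
  have hzd : p.fiberι y z ⤳ d := by
    have := hz.map (p.fiberι y).continuous
    rwa [Scheme.Hom.fiberι_fiberHomeo_symm] at this
  exact eq_fiberHomeo_symm_of_fiberι_eq p hd (H _ hpz hzd)

/-- **Points closed in their fibre are closed points of the fibre scheme**: if `c` specializes
to no other point of `p⁻¹(y)`, the point of `p.fiber y` defined by `c` is closed. [folklore] -/
theorem isClosed_singleton_fiberHomeo_symm {c : C} (hc : p c = y)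
    (H : ∀ e : C, p e = y → c ⤳ e → e = c) :
    IsClosed ({(p.fiberHomeo y).symm ⟨c, hc⟩} : Set ↥(p.fiber y)) := by
  rw [← closure_subset_iff_isClosed]
  intro z hz
  have hcz : (p.fiberHomeo y).symm ⟨c, hc⟩ ⤳ z := specializes_iff_mem_closure.mpr hz
  have hpz : p (p.fiberι y z) = y := Literature.AlgebraicGeometry.Motives.apply_fiberι p y z
  have hcz' : c ⤳ p.fiberι y z := by
    have := hcz.map (p.fiberι y).continuous
    rwa [Scheme.Hom.fiberι_fiberHomeo_symm] at this
  exact eq_fiberHomeo_symm_of_fiberι_eq p hc (H _ hpz hcz')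

/-- `p.asFiber c` is the point of the fibre defined by `c`. [folklore] -/
theorem asFiber_eq_fiberHomeo_symm (c : C) : p.asFiber c = (p.fiberHomeo (p c)).symm ⟨c, rfl⟩ :=
  rfl

end FibrePoints

namespace IsSemiStableCurve

variable {C S : Scheme.{u}} {p : C ⟶ S}

/-- **At most two branches of the fibre through a point closed in it** (de Jong 1996, 4.20,
Case 1), stated with points of `𝒞`: for a semi-stable curve `p : 𝒞 → S`, a point `c` which is
closed in its fibre `p⁻¹(p c)`, and three maximal points `d₁, d₂, d₃` of that fibre (no other
point of the fibre specializes to them) which specialize to `c`, two of the `dᵢ` coincide.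
[cite: DeJong1996, Lemma 4.20 Case 1, p. 74] -/
theorem not_three_maximal_specializes (h : IsSemiStableCurve p) {c : C}
    (hc : ∀ e : C, p e = p c → c ⤳ e → e = c) {d₁ d₂ d₃ : C} (hp₁ : p d₁ = p c)
    (hp₂ : p d₂ = p c) (hp₃ : p d₃ = p c) (hm₁ : ∀ e : C, p e = p c → e ⤳ d₁ → e = d₁)
    (hm₂ : ∀ e : C, p e = p c → e ⤳ d₂ → e = d₂) (hm₃ : ∀ e : C, p e = p c → e ⤳ d₃ → e = d₃)
    (h₁ : d₁ ⤳ c) (h₂ : d₂ ⤳ c) (h₃ : d₃ ⤳ c) : d₁ = d₂ ∨ d₁ = d₃ ∨ d₂ = d₃ := by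
  have key := h.not_three_genericPoints_fiber_specializes (p c)
    (isClosed_singleton_fiberHomeo_symm p rfl hc)
    (fiberHomeo_symm_mem_genericPoints p hp₁ hm₁) (fiberHomeo_symm_mem_genericPoints p hp₂ hm₂)
    (fiberHomeo_symm_mem_genericPoints p hp₃ hm₃)
    ((fiberHomeo_symm_specializes_iff p hp₁ rfl).mpr h₁)
    ((fiberHomeo_symm_specializes_iff p hp₂ rfl).mpr h₂)
    ((fiberHomeo_symm_specializes_iff p hp₃ rfl).mpr h₃)
  rcases key with e | e | e
  · left; simpa using congrArg (fun z => (p.fiberι (p c) z : C)) e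
  · right; left; simpa using congrArg (fun z => (p.fiberι (p c) z : C)) e
  · right; right; simpa using congrArg (fun z => (p.fiberι (p c) z : C)) e

/-- **Maximal points of the fibres of a semi-stable curve lie in the smooth locus** (de Jong
1996, 4.21: "the smooth locus of `𝒞 → S` is dense in all fibres"), stated with points of `𝒞`.
[cite: DeJong1996, 4.21, p. 74] -/
theorem mem_smoothLocus_of_maximal (h : IsSemiStableCurve p) [LocallyOfFinitePresentation p]
    {d : C} (hm : ∀ e : C, p e = p d → e ⤳ d → e = d) : d ∈ p.smoothLocus := by
  have := h.mem_smoothLocus_of_mem_genericPoints_fiber (p d)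
    (fiberHomeo_symm_mem_genericPoints p rfl hm)
  simpa using this

end IsSemiStableCurve

/-- **One branch of the fibre through a point of the smooth locus** (de Jong 1996, 4.20, Case 2),
stated with points of `𝒞`: for `p` locally of finite presentation, `c ∈ sm(𝒞/S)`, and two
maximal points `d₁, d₂` of the fibre `p⁻¹(p c)` specializing to `c`, `d₁ = d₂`.
[cite: DeJong1996, Lemma 4.20 Case 2, p. 74] -/
theorem eq_of_maximal_specializes_of_mem_smoothLocus {C S : Scheme.{u}} (p : C ⟶ S)
    [LocallyOfFinitePresentation p] {c : C} (hc : c ∈ p.smoothLocus) {d₁ d₂ : C}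
    (hp₁ : p d₁ = p c) (hp₂ : p d₂ = p c) (hm₁ : ∀ e : C, p e = p c → e ⤳ d₁ → e = d₁)
    (hm₂ : ∀ e : C, p e = p c → e ⤳ d₂ → e = d₂) (h₁ : d₁ ⤳ c) (h₂ : d₂ ⤳ c) : d₁ = d₂ := by
  have key := eq_of_genericPoints_fiber_specializes_of_mem_smoothLocus p hc
    (fiberHomeo_symm_mem_genericPoints p hp₁ hm₁) (fiberHomeo_symm_mem_genericPoints p hp₂ hm₂)
    ((fiberHomeo_symm_specializes_iff p hp₁ rfl).mpr h₁)
    ((fiberHomeo_symm_specializes_iff p hp₂ rfl).mpr h₂)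
  simpa using congrArg (fun z => (p.fiberι (p c) z : C)) key

end Literature.AlgebraicGeometry.Resolution

end
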